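import Mathlib
import HarnessLib
import Summits.NavierStokesRegularity.NavierStokesRegularity.Theorems.TypeILiouvilleTypeIliouvilleLInertialGaugeClassical
import Summits.NavierStokesRegularity.NavierStokesRegularity.Theorems.UnthreadedDoorCellFluxSpaceTimeAnalyticityModGauge
import Summits.NavierStokesRegularity.NavierStokesRegularity.Theorems.UnthreadedDoorCellFluxGaugeRigidityAlgebra

/-!
# Route `UnthreadedDoor`, crux `PoloidalLiouville` (stmt-NavierStokesRegularity-1222), WALL W1 — crux idea «cell-flux» (ns-idea-14), stub Σ-5a
# `UnthreadedGaugeRigidity`: THE ANALYTIC INERTIAL FRAME and the analyticity of its vorticity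

Steps (i)–(ii) of the custodian's SHORT ROAD (director-ns KEY-NS #218 (2)(b), owner ns-qj-p1 g7), all inputs imported BY NAME:
* `exists_analytic_inertialFrame` — a bounded ancient mild solution `v` (`ν = 1`) which is jointly `C^∞` on the open slab has a frame path
  `ξ ∈ C^∞(Iio 0)` (ARM A's `Theorems.inertialGauge_of_smooth`, p713033) whose inertial representative `V t y = v t (y + ξ t) − ξ′ t` is JOINTLY
  REAL-ANALYTIC on the slab: truncate `V` off the slab (`TypeIliouvilleL.InertialGauge.stronglyMeasurable_truncate`, `truncate_apply_of_neg`) for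
  measurability, transfer the bound / continuity / Oseen-mild identity (`oseenDuhamel_congr_Ioo`), apply `oseenGauge_analyticOnNhd_uncurry`
  (p700714 file: Lemarié-Rieusset Thm 9.12), and undo the truncation on the open slab.
* `fderiv_slice_eq` — on the slab, `fderiv (V t) y = (fderiv (uncurry V) (t,y)) ∘L inr`;
* `analyticOnNhd_curl_uncurry` — the curl is a FIXED continuous linear map of the Fréchet derivative, hence `(t,y) ↦ curl (V t) y` is jointly
  analytic on the slab whenever `uncurry V` is.
Nothing here proves an NS regularity statement; Σ-5a's assembly is `…CellFluxGaugeRigidity.lean`.  `--supports stmt-NavierStokesRegularity-1222 --as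
helper`.  [cite: LemarieRieusset2016, Thm. 9.12; KochNadirashviliSereginSverak2009, §4 (i)]
-/

noncomputable section

-- the summit and its single sub-problem share the name (CONVENTIONS §1)
set_option linter.dupNamespace false

open Set Function Filter Topology InnerProductSpace MeasureTheory
open scoped RealInnerProductSpace ContDiff

namespace Summit.NavierStokesRegularity.NavierStokesRegularity.Theorems.PoloidalLiouville.CellFlux

open Literature.Analysis Literature.Analysis.FluidPDE
open Summit.NavierStokesRegularity.NavierStokesRegularity.Theorems.TypeIliouvilleL.InertialGauge
  (stronglyMeasurable_truncate truncate_apply_of_neg)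
open Summit.NavierStokesRegularity.NavierStokesRegularity.Theorems.PoloidalLiouville.HorizonTower (E3 cross_fin3)

/-- The open slab `(−∞,0) × ℝ³`. [folklore] -/
theorem isOpen_slab : IsOpen (Iio (0 : ℝ) ×ˢ (univ : Set E3)) := isOpen_Iio.prod isOpen_univ

/-- **The analytic inertial frame.**  For a bounded ancient mild solution (`ν = 1`) jointly smooth on the open slab there is a frame path
`ξ ∈ C^∞(Iio 0)` whose inertial representative `(t,y) ↦ v t (y + ξ t) − ξ′ t` is jointly real-analytic on the slab.
[cite: LemarieRieusset2016, Thm. 9.12; KochNadirashviliSereginSverak2009, §4 (i)] -/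
theorem exists_analytic_inertialFrame (v : ℝ → E3 → E3) (hv : IsBoundedAncientMildSolution 1 v)
    (hsm : ContDiffOn ℝ (⊤ : ℕ∞) (uncurry v) (Iio 0 ×ˢ univ)) :
    ∃ ξ : ℝ → E3, ContDiffOn ℝ ∞ ξ (Iio 0) ∧
      AnalyticOnNhd ℝ (uncurry fun t y => v t (y + ξ t) - deriv ξ t) (Iio (0 : ℝ) ×ˢ (univ : Set E3)) := by
  obtain ⟨ξ, hξ, M, hM, hVc, _hdiv, hmild⟩ := Theorems.inertialGauge_of_smooth v hv hsm
  refine ⟨ξ, hξ, ?_⟩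
  set V : ℝ → E3 → E3 := fun t y => v t (y + ξ t) - deriv ξ t with hV
  -- the truncation of `V` off the slab
  set W : ℝ → E3 → E3 := fun t x => (Iio (0 : ℝ) ×ˢ (univ : Set E3)).piecewise (uncurry V) 0 (t, x) with hW
  have hWV : ∀ t < 0, ∀ x, W t x = V t x := fun t ht x => truncate_apply_of_neg V ht x
  have hWVfun : ∀ t < 0, W t = V t := fun t ht => funext (hWV t ht)
  have hWm : Measurable (uncurry W) := by
    have h := stronglyMeasurable_truncate (u := V) hVc
    exact h.measurable
  have hEq : EqOn (uncurry W) (uncurry V) (Iio (0 : ℝ) ×ˢ (univ : Set E3)) := by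
    rintro ⟨t, x⟩ ⟨ht, -⟩
    exact hWV t ht x
  have hWc : ContinuousOn (uncurry W) (Iio 0 ×ˢ univ) := hVc.congr hEq
  have hWK : ∀ t < 0, ∀ x, ‖W t x‖ ≤ M := fun t ht x => by rw [hWV t ht x]; exact hM t ht x
  have hWmild : ∀ s t : ℝ, s < t → t < 0 → ∀ x,
      W t x = UnboundedOperators.heatExtension (W s) (t - s) x - oseenDuhamel 1 s W W t x := by
    intro s t hst ht0 x
    have hs0 : s < 0 := hst.trans ht0
    have hτ : ∀ τ ∈ Ioo s t, W τ = V τ := fun τ hτ => hWVfun τ (hτ.2.trans ht0)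
    rw [hWV t ht0 x, hWVfun s hs0, oseenDuhamel_congr_Ioo hτ hτ x]
    exact hmild s t hst ht0 x
  have hA : AnalyticOnNhd ℝ (uncurry W) (Iio (0 : ℝ) ×ˢ (univ : Set E3)) :=
    oseenGauge_analyticOnNhd_uncurry hWm hWc hWK hWmild
  exact hA.congr isOpen_slab hEq

/-! ### The curl as a fixed linear map of the derivative -/

/-- On the open slab, the derivative of a slice of a differentiable `F : ℝ × ℝ³ → ℝ³` is the total derivative composed with the inclusion
`y ↦ (0, y)`. [folklore] -/
theorem fderiv_slice_eq {F : ℝ × E3 → E3} {p : ℝ × E3} (hF : DifferentiableAt ℝ F p) :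
    fderiv ℝ (fun y => F (p.1, y)) p.2 = (fderiv ℝ F p).comp (ContinuousLinearMap.inr ℝ ℝ E3) := by
  have h1 : HasFDerivAt (fun y : E3 => (p.1, y)) (ContinuousLinearMap.inr ℝ ℝ E3) p.2 := hasFDerivAt_prodMk_right p.1 p.2
  have h2 : HasFDerivAt F (fderiv ℝ F p) (p.1, p.2) := by rw [Prod.mk.eta]; exact hF.hasFDerivAt
  exact (h2.comp p.2 h1).fderiv

/-- **Joint analyticity of the vorticity of an analytic frame.**  If `uncurry V` is real-analytic on the open slab, so is `(t,y) ↦ curl (V t) y`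
(the curl is a fixed continuous linear map of the partial derivative, which is the analytic total derivative composed with a fixed inclusion).
[folklore] -/
theorem analyticOnNhd_curl_uncurry {V : ℝ → E3 → E3}
    (hV : AnalyticOnNhd ℝ (uncurry V) (Iio (0 : ℝ) ×ˢ (univ : Set E3))) :
    AnalyticOnNhd ℝ (fun p : ℝ × E3 => curl (V p.1) p.2) (Iio (0 : ℝ) ×ˢ (univ : Set E3)) := by
  -- the curl read off a linear map `A : ℝ³ →L ℝ³`, as a (continuous) linear map of `A`
  let curlL : (E3 →L[ℝ] E3) →ₗ[ℝ] E3 :=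
    { toFun := fun A => WithLp.toLp 2 ![A (EuclideanSpace.single 1 1) 2 - A (EuclideanSpace.single 2 1) 1,
        A (EuclideanSpace.single 2 1) 0 - A (EuclideanSpace.single 0 1) 2,
        A (EuclideanSpace.single 0 1) 1 - A (EuclideanSpace.single 1 1) 0]
      map_add' := fun A B => by
        ext i
        fin_cases i <;> simp <;> ring
      map_smul' := fun c A => by
        ext i
        fin_cases i <;> simp <;> ring }
  let Lc : (E3 →L[ℝ] E3) →L[ℝ] E3 := LinearMap.toContinuousLinearMap curlL
  have hcurl : ∀ (u : E3 → E3) (x : E3), curl u x = Lc (fderiv ℝ u x) := fun u x => by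
    simp only [Lc, LinearMap.coe_toContinuousLinearMap']
    rfl
  -- the total derivative is analytic, and so is its image under the fixed CLM `A ↦ Lc (A ∘L inr)`
  have hD : AnalyticOnNhd ℝ (fderiv ℝ (uncurry V)) (Iio (0 : ℝ) ×ˢ (univ : Set E3)) := hV.fderiv
  set L : (ℝ × E3 →L[ℝ] E3) →L[ℝ] E3 :=
    Lc.comp ((ContinuousLinearMap.compL ℝ E3 (ℝ × E3) E3).flip (ContinuousLinearMap.inr ℝ ℝ E3)) with hL
  have hLA : AnalyticOnNhd ℝ (fun p => L (fderiv ℝ (uncurry V) p)) (Iio (0 : ℝ) ×ˢ (univ : Set E3)) :=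
    L.comp_analyticOnNhd hD
  refine hLA.congr isOpen_slab ?_
  rintro p hp
  have hdiff : DifferentiableAt ℝ (uncurry V) p := (hV p hp).differentiableAt
  have hslice : fderiv ℝ (V p.1) p.2 = (fderiv ℝ (uncurry V) p).comp (ContinuousLinearMap.inr ℝ ℝ E3) := by
    have := fderiv_slice_eq hdiff
    simpa only [uncurry_apply_pair] using this
  show L (fderiv ℝ (uncurry V) p) = curl (V p.1) p.2
  rw [hcurl, hslice, hL]
  simp [ContinuousLinearMap.compL]

/-! ### Analyticity bookkeeping for `ℝ³`-valued functions of one real variable -/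

/-- An `ℝ³`-valued function of a real variable is analytic at a point if its three coordinates are. [folklore] -/
theorem analyticAt_of_coord {f : ℝ → E3} {t : ℝ} (h : ∀ i : Fin 3, AnalyticAt ℝ (fun s => f s i) t) : AnalyticAt ℝ f t := by
  have hpi : AnalyticAt ℝ (fun s => fun i => f s i) t := AnalyticAt.pi h
  have heq : f = fun s => (EuclideanSpace.equiv (Fin 3) ℝ).symm (fun i => f s i) := by
    funext s
    ext i
    simp
  rw [heq]
  exact ((EuclideanSpace.equiv (Fin 3) ℝ).symm.analyticAt _).comp hpi

/-- Coordinates of an analytic `ℝ³`-valued function are analytic. [folklore] -/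
theorem analyticAt_coord {f : ℝ → E3} {t : ℝ} (h : AnalyticAt ℝ f t) (i : Fin 3) : AnalyticAt ℝ (fun s => f s i) t :=
  (((EuclideanSpace.proj i : E3 →L[ℝ] ℝ).analyticAt _).comp h).congr (Eventually.of_forall fun _ => rfl)

/-- The cross product of analytic `ℝ³`-valued functions is analytic. [folklore] -/
theorem analyticAt_cross {b c : ℝ → E3} {t : ℝ} (hb : AnalyticAt ℝ b t) (hc : AnalyticAt ℝ c t) :
    AnalyticAt ℝ (fun s => cross (b s) (c s)) t := by
  have hb' := analyticAt_coord hb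
  have hc' := analyticAt_coord hc
  refine analyticAt_of_coord fun i => ?_
  fin_cases i
  · show AnalyticAt ℝ (fun s => cross (b s) (c s) 0) t
    have e : (fun s => cross (b s) (c s) 0) = fun s => b s 1 * c s 2 - b s 2 * c s 1 :=
      funext fun s => (cross_fin3 (b s) (c s)).1
    rw [e]
    exact ((hb' 1).fun_mul (hc' 2)).fun_sub ((hb' 2).fun_mul (hc' 1))
  · show AnalyticAt ℝ (fun s => cross (b s) (c s) 1) t
    have e : (fun s => cross (b s) (c s) 1) = fun s => b s 2 * c s 0 - b s 0 * c s 2 :=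
      funext fun s => (cross_fin3 (b s) (c s)).2.1
    rw [e]
    exact ((hb' 2).fun_mul (hc' 0)).fun_sub ((hb' 0).fun_mul (hc' 2))
  · show AnalyticAt ℝ (fun s => cross (b s) (c s) 2) t
    have e : (fun s => cross (b s) (c s) 2) = fun s => b s 0 * c s 1 - b s 1 * c s 0 :=
      funext fun s => (cross_fin3 (b s) (c s)).2.2
    rw [e]
    exact ((hb' 0).fun_mul (hc' 1)).fun_sub ((hb' 1).fun_mul (hc' 0))

/-- The inner product of analytic `ℝ³`-valued functions is analytic. [folklore] -/
theorem analyticAt_inner {a w : ℝ → E3} {t : ℝ} (ha : AnalyticAt ℝ a t) (hw : AnalyticAt ℝ w t) :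
    AnalyticAt ℝ (fun s => ⟪a s, w s⟫) t :=
  ((innerSL ℝ (E := E3)).analyticAt_bilinear (a t, w t)).comp₂ ha hw

end Summit.NavierStokesRegularity.NavierStokesRegularity.Theorems.PoloidalLiouville.CellFlux

end
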